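import Summits.CriticalPhenomena.PercolationContinuityZ3.Theorems.PercNearOneGluingAdditiveGluingSetObserverUnfoldMain
import Summits.CriticalPhenomena.PercolationContinuityZ3.Theorems.PercNearOneGluingAdditiveGluingSetObserverHpart
import Summits.CriticalPhenomena.PercolationContinuityZ3.Theorems.PercNearOneGluingAdditiveGluingSetObserverInduction
import Summits.CriticalPhenomena.PercolationContinuityZ3.Theorems.PercNearOneGluingAdditiveGluingSetObserverAssembly
import HarnessLib

/-!
# Conjecture G / SET-W via a SET observer, XX: THEOREM 1-set (the set-observer conditioned slack hierarchy holds) and CONJECTURE G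
# (the V⁺ stub `stub_fingerML3_vp`) FOR EVERY WEIGHTING `K < 1`, UNCONDITIONALLY

Support file (`--supports stmt-CriticalPhenomena-4576`); no definitions, no named facts, no sorries.  Seat (b) V⁺-form `png-dp-vplus`, gen 13
(memo MEMO-gen12.md §4–§7, §10–§13).  The last assembly step of the set-observer programme of gens 10–13:
* `CSHSet.cshSetHolds` — **THEOREM 1-set**: `CSHSetHolds w x Y D O v` for every weight vector `w < 1` (zeros allowed), owner `x`, avoided set `Y`,
  distinct decoys `D`, vertex observer `v` and observer SET `O` off the named vertices.  Proof = gen 12's induction skeleton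
  `CSHSet.cshSetHolds_of_unfold` (strong induction on the number of decoys over LEMMA T-set `CSHSet.cshMarginSet_nonneg_of_within`) with its step
  `hU` discharged IN PLACE by LEMMA U-set `CSHSet.within_nonneg_of_hpart_set` (world-wise unfolding with the defect lemma on the set slot; the
  `match`-slot events of the skeleton are plugged into the abstract slot family `Ev` by unification) and LEMMA H-set `CSHSet.hpart_set_sum_nonneg`
  ((K6-set) world by world + (Htw-set) from META-A2 for the killed set observer).
* `CSHSet.cshSetAll` — the same in the `Fin n` / `Finset` hypothesis shape of `CSHSet.fingerML3_of_cshSet`.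
* **`CSHSet.fingerML3_vp_of_lt_one`** — CONJECTURE G, i.e. the statement of the registered V⁺ stub `stub_fingerML3_vp` of the crux
  `PercNearOneGluing.AdditiveGluing` (stmt-CriticalPhenomena-4576), for every weighting `K < 1` of the unglued system: for a block `N` with contacts
  in `A ∋ b` and a designated relay `d ∈ A` of least `μ_K(· ↔ b)`, `μ_{K/N}(R ∩ {d ↔ b}) ≤ μ_{K/N}(R ∩ ⋃_{v∈N}{v ↔ b})` — Kozma–Nitzan's display (3)
  at the contracted vertex of `Γ/N` with the witness designated in `Γ` ("K-designated Theorem 4" / SET-W, memo MEMO-gen10 §3), now a theorem.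
  (Weight-`1` pairs of `K` remain excluded: the stub as registered allows them; see the file's closing remark.)
[cite: KozmaNitzan2024, Thm 4 (pp. 12–14), display (3) (p. 3), Conj. 4 (p. 32)] [cite: VandenbergHaggstromKahn2005, §2.1 (pp. 9–13), Thm. 2.1 (p. 9)]
-/

noncomputable section

namespace Summit.CriticalPhenomena.PercolationContinuityZ3.Theorems

open MeasureTheory Set Literature.Probability.LatticeModels Literature.Probability.Percolation
open scoped Classical

namespace CSHSet

open CSH HullPort BHK2006 DecisionTree

variable {V : Type*} [Fintype V]

/-- **THEOREM 1-set — the set-observer conditioned slack hierarchy holds** (weights `< 1`, named vertices distinct and off the observer set):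
`0 ≤ cshMarginSet w x Y D O v f` for every monotone functional `f` of the open edge cluster of the owner.
(transcription of the cell memo png-dp-vplus MEMO-gen12.md §4; assembled from the landed pieces of gens 12–13)
[cite: VandenbergHaggstromKahn2005, §2.1 (pp. 9–13)] [cite: KozmaNitzan2024, Conj. 4 (p. 32)] -/
theorem cshSetHolds (w : Sym2 V → unitInterval) (hw : ∀ e, w e < 1) (O : Finset V) (x : V) (Y : Set V) (D : List V) (v : V)
    (hxY : x ∉ Y) (hv : v ∉ insert x Y) (hnd : D.Nodup) (hdis : ∀ d ∈ D, d ∉ insert x Y ∧ d ≠ v)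
    (hO : ∀ o ∈ O, o ∉ insert x Y ∧ o ≠ v ∧ o ∉ D) : CSHSetHolds w x Y D O v := by
  refine cshSetHolds_of_unfold w hw O ?_ x Y D v hxY hv hnd hdis hO
  intro x Y D v _hxY hv hnd hdis hO hIH g hg hg0
  have hD' : ∀ d ∈ D, d ≠ x ∧ d ∉ Y ∧ d ≠ v ∧ d ∉ O := fun d hd => by
    obtain ⟨h1, h2⟩ := hdis d hd
    rw [mem_insert_iff, not_or] at h1
    exact ⟨h1.1, h1.2, h2, fun hdO => (hO d hdO).2.2 hd⟩
  have hv' : v ≠ x ∧ v ∉ Y := by rwa [mem_insert_iff, not_or] at hv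
  have hvS : v ∉ insert x D.toFinset := by
    rw [Finset.mem_insert, List.mem_toFinset, not_or]
    exact ⟨hv'.1, fun h => (hdis v h).2 rfl⟩
  refine within_nonneg_of_hpart_set w hw x Y D O v hnd hD' hg _ (fun ω ζ => ?_) (fun ω u => rfl) hIH ?_
  · -- the set-slot event of the skeleton: `1{O ~ x in ζ} · 1{O off Y ∪ V(C_Y(ω))}`
    change ind {η : BondConfig V | (∃ o ∈ O, (openGraph η).Reachable o x) ∧ ∀ o ∈ O, ¬ (o ∈ Y ∨ ∃ e ∈ setCl ω Y, o ∈ e)} ζ = _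
    by_cases hl : ∀ o ∈ O, ¬ (o ∈ Y ∨ ∃ e ∈ setCl ω Y, o ∈ e)
    · have hl' : ω ∈ {β : Set (Sym2 V) | ∀ o ∈ O, β ∈ avoidEv o Y} := fun o ho => (mem_avoidEv_iff_notMem_span o Y ω).2 (hl o ho)
      rw [ind_of_mem hl', one_mul]
      by_cases hr : ∃ o ∈ O, (openGraph ζ).Reachable o x
      · rw [ind_of_mem (show ζ ∈ {ζ' : Set (Sym2 V) | ∃ o ∈ O, (openGraph ζ').Reachable o x} from hr), ind_of_mem]
        exact ⟨hr, hl⟩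
      · rw [ind_of_not_mem (show ζ ∉ {ζ' : Set (Sym2 V) | ∃ o ∈ O, (openGraph ζ').Reachable o x} from hr), ind_of_not_mem]
        exact fun h => hr h.1
    · have hl' : ω ∉ {β : Set (Sym2 V) | ∀ o ∈ O, β ∈ avoidEv o Y} :=
        fun h => hl fun o ho => (mem_avoidEv_iff_notMem_span o Y ω).1 (h o ho)
      rw [ind_of_not_mem hl', zero_mul, ind_of_not_mem]
      exact fun h => hl h.2
  · -- LEMMA H-set at the marker set `{x} ∪ D`
    have key := hpart_set_sum_nonneg w hw x Y (insert x D.toFinset) (Finset.mem_insert_self x _) O v hvS hv'.2 g hg hg0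
    have hS : ((↑(insert x D.toFinset) : Set V) ∪ Y) = insert x Y ∪ {d | d ∈ D} := by
      ext u
      simp only [Finset.coe_insert, mem_union, mem_insert_iff, Finset.mem_coe, List.mem_toFinset, mem_setOf_eq]
      tauto
    rw [hS] at key
    exact key

/-- THEOREM 1-set in the `Fin n` / `Finset` hypothesis shape of `CSHSet.fingerML3_of_cshSet`.
[cite: VandenbergHaggstromKahn2005, §2.1 (pp. 9–13)] -/
theorem cshSetAll {n : ℕ} (w : Sym2 (Fin n) → unitInterval) (hw : ∀ e, w e < 1) (O : Finset (Fin n)) :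
    ∀ (v x : Fin n) (Y : Finset (Fin n)) (D : List (Fin n)),
      x ∉ Y → v ≠ x → v ∉ Y → D.Nodup → (∀ d ∈ D, d ≠ x ∧ d ∉ Y ∧ d ≠ v) →
      (∀ o ∈ O, o ≠ x ∧ o ∉ Y ∧ o ≠ v ∧ o ∉ D) → CSHSetHolds w x (↑Y : Set (Fin n)) D O v := by
  intro v x Y D hxY hvx hvY hD hdis hO
  refine cshSetHolds w hw O x (↑Y : Set (Fin n)) D v (fun h => hxY (Finset.mem_coe.1 h)) ?_ hD ?_ ?_
  · simp only [mem_insert_iff, Finset.mem_coe, not_or]; exact ⟨hvx, hvY⟩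
  · intro d hd
    obtain ⟨h1, h2, h3⟩ := hdis d hd
    exact ⟨by simp only [mem_insert_iff, Finset.mem_coe, not_or]; exact ⟨h1, h2⟩, h3⟩
  · intro o ho
    obtain ⟨h1, h2, h3, h4⟩ := hO o ho
    exact ⟨by simp only [mem_insert_iff, Finset.mem_coe, not_or]; exact ⟨h1, h2⟩, h3, h4⟩

/-- **CONJECTURE G for every weighting `K < 1` — the statement of the registered V⁺ stub `stub_fingerML3_vp` of the crux `AdditiveGluing`
(stmt-CriticalPhenomena-4576) under `K < 1`, unconditionally.**  For a block `N` with contacts in `A ∋ b` and a designated relay `d ∈ A` of least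
`μ_K(· ↔ b)`:  `μ_{K/N}(R ∩ {d ↔ b}) ≤ μ_{K/N}(R ∩ ⋃_{v∈N} {v ↔ b})`, `R = {some hair of N to A is open}`, `K/N` = the pairs inside `N` forced open.
Chain: THEOREM 1-set (`cshSetAll`) ⟹ (pS5D)-set ⟹ the set two-observer margin ⟹ (S-Δ) ⟹ SET-W ⟹ the stub (`CSHSet.fingerML3_of_cshSet`, gen 12).
[cite: KozmaNitzan2024, Thm 4 (pp. 12–14), display (3) (p. 3), Conj. 4 (p. 32)] [cite: VandenbergHaggstromKahn2005, Thm. 2.1 (p. 9)] -/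
theorem fingerML3_vp_of_lt_one {n : ℕ} (K : Sym2 (Fin n) → unitInterval) (hK : ∀ e, K e < 1) (A N : Finset (Fin n)) (d b : Fin n)
    (hbA : b ∈ A) (hNA : Disjoint N A) (hdA : d ∈ A) (hfree : ∀ v ∈ N, ∀ y : Fin n, y ∉ A → y ∉ N → (K s(v, y) : ℝ) = 0)
    (hmin : ∀ a ∈ A, (prodBernoulli K).real (openConn d b) ≤ (prodBernoulli K).real (openConn a b)) :
    (prodBernoulli (fun e' : Sym2 (Fin n) => if (∀ y ∈ e', y ∈ N) ∧ ¬ e'.IsDiag then 1 else K e')).real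
        ({ω : Set (Sym2 (Fin n)) | ∃ v ∈ N, ∃ a ∈ A, s(v, a) ∈ ω} ∩ openConn d b) ≤
      (prodBernoulli (fun e' : Sym2 (Fin n) => if (∀ y ∈ e', y ∈ N) ∧ ¬ e'.IsDiag then 1 else K e')).real
        ({ω : Set (Sym2 (Fin n)) | ∃ v ∈ N, ∃ a ∈ A, s(v, a) ∈ ω} ∩ ⋃ v ∈ N, openConn v b) :=
  fingerML3_of_cshSet K hK A N d b hbA hNA hdA hfree hmin (cshSetAll K hK N)

end CSHSet

end Summit.CriticalPhenomena.PercolationContinuityZ3.Theorems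

end
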